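import Mathlib
import Summits.PneNP.PneNP.Theorems.PstarGapLemma
import Summits.PneNP.PneNP.Theorems.PstarSAClosure
import Summits.PneNP.PneNP.Theorems.PstarGapPeeling

/-!
# The support-charged gap bound: a minimal infeasible set is at most twice the boundary hit by the parity supports (ROUND-24)

FRONTIER range-avoidance ladder (cell `pnp-ideate`, ROUND-24 gap-lemma programme `PstarGapLemma`; restricted-model combinatorics —
nothing here bears on `P` versus `NP`).

The crux `PstarGapLemma.PstarGapLemmaSO` asks for `|J| ≤ K(Δ)·|W|` for minimal `W`-infeasible output sets `J` of an expanding
instance.  This file proves the SUPPORT-CHARGED form, for every pure `P⋆` instance (no typedness, no simple overlaps, no degree bound)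
and every parity system `W` with total support `wsupp W = ⋃_{(S,b) ∈ W} S`:

* `card_bdry_sdiff_wsupp_le`: if `J` is minimal `W`-infeasible then `|bdry J ∖ wsupp W| ≤ |J|` — otherwise some output owns two
  `J`-private variables untouched by `W` (`PstarSAClosure.exists_two_private`) and the peeling repair of `PstarGapPeeling` (flip a
  private XOR slot, or set a private AND pair to `(c,c)`) turns a witness for `J ∖ {j}` into one for `J` WITHOUT disturbing `W`
  (`feasible_of_two_private`);
* `card_le_two_mul_card_bdry_inter`: with `(r, 3/2)`-boundary expansion and `|J| ≤ r`, `|J| ≤ 2·|bdry J ∩ wsupp W| ≤ 2·|wsupp W|`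
  (`card_le_two_mul_card_wsupp`); in particular (`card_le_of_sparse`) parities of support `≤ d` obey the gap bound with constant `2d`
  — the sparse half of the crux (cf. T24.6 `PstarPDTFromSA` at the decision-tree level) — and `W = ∅` gives back T24.8a.

So the open content of the crux is exactly the DENSE parities: a minimal infeasible `J` must have at least `|J|/2` of its boundary
variables inside the supports of `W` (memo ROUND-24-PRESEED §13 R8 (iii), made quantitative).
-/

set_option linter.dupNamespace false -- `Summit.PneNP.PneNP.…`: summit = sub-problem name (D-0017 single-conjunct layout)

open Finset Literature.Computability.Complexity
open Summit.PneNP.PneNP.Theorems.PstarPDT (parity)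
open Summit.PneNP.PneNP.Theorems.PstarSALevel (varSet bdry BoundaryExpanding)
open Summit.PneNP.PneNP.Theorems.PstarSAClosure (exists_two_private)
open Summit.PneNP.PneNP.Theorems.PstarGapLemma (Sat Feasible MinInfeasible)
open Summit.PneNP.PneNP.Theorems.PstarGapPeeling (not_mem_varSet_of_private eval_update_of_not_mem eval_update_xor_slot
  eval_update_and_pair)

namespace Summit.PneNP.PneNP.Theorems.PstarGapSupport

variable {n m : ℕ}

/-! ## Supports -/

/-- The total support of a parity system: all variables read by some constraint. -/
def wsupp (W : Finset (Finset (Fin n) × Bool)) : Finset (Fin n) := W.biUnion Prod.fst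

/-- Membership in the total support. -/
theorem mem_wsupp {W : Finset (Finset (Fin n) × Bool)} {v : Fin n} : v ∈ wsupp W ↔ ∃ e ∈ W, v ∈ e.1 := by
  simp [wsupp]

/-- The total support has at most `Σ |supports|` elements; with supports of size `≤ d`, at most `d·|W|`. -/
theorem card_wsupp_le {W : Finset (Finset (Fin n) × Bool)} {d : ℕ} (hd : ∀ e ∈ W, e.1.card ≤ d) : (wsupp W).card ≤ d * W.card := by
  unfold wsupp
  refine card_biUnion_le.trans ?_
  calc ∑ e ∈ W, e.1.card ≤ ∑ _e ∈ W, d := sum_le_sum hd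
    _ = d * W.card := by rw [sum_const, smul_eq_mul, mul_comm]

/-- Updating a variable outside `S` does not change the parity on `S`. -/
theorem parity_update_of_notMem {S : Finset (Fin n)} {v : Fin n} (hv : v ∉ S) (z : Fin n → Bool) (b : Bool) :
    parity S (Function.update z v b) = parity S z := by
  unfold PstarPDT.parity
  have h : (S.filter fun w => Function.update z v b w = true) = S.filter fun w => z w = true := by
    refine filter_congr fun w hw => ?_
    have hne : w ≠ v := fun h => hv (by rw [← h]; exact hw)
    rw [Function.update_of_ne hne]
  rw [h]

/-- Updating a variable outside the total support keeps `W` satisfied. -/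
theorem sat_update_of_notMem {W : Finset (Finset (Fin n) × Bool)} {v : Fin n} (hv : v ∉ wsupp W) {z : Fin n → Bool}
    (hz : Sat W z) (b : Bool) : Sat W (Function.update z v b) := by
  intro e he
  rw [parity_update_of_notMem (fun h => hv (mem_wsupp.2 ⟨e, he, h⟩)) z b]
  exact hz e he

/-! ## The repair step -/

/-- **Repair without disturbing `W`.**  If the output `j ∈ J` of a pure `P⋆` instance owns two `J`-private variables outside the
total support of `W`, then a `W`-witness for `J ∖ {j}` can be repaired into a `W`-witness for `J`. -/
theorem feasible_of_two_private (I : LocalMap 4 n m) (hI : I.IsPure xorAndPred) (y : Fin m → Bool)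
    (W : Finset (Finset (Fin n) × Bool)) {J : Finset (Fin m)} {j : Fin m} (hj : j ∈ J)
    (hP : 2 ≤ ((bdry I J \ wsupp W).filter fun v => v ∈ varSet I j).card) (hF : Feasible I y W (J.erase j)) :
    Feasible I y W J := by
  classical
  set P := (bdry I J \ wsupp W).filter fun v => v ∈ varSet I j with hPdef
  obtain ⟨z₀, hW₀, hz₀⟩ := hF
  have hpriv : ∀ v ∈ P, ∀ j' ∈ J, j' ≠ j → v ∉ varSet I j' := fun v hv j' hj' hne' =>
    not_mem_varSet_of_private I hj hj' hne' (mem_sdiff.1 (mem_filter.1 hv).1).1 (mem_filter.1 hv).2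
  have hout : ∀ v ∈ P, v ∉ wsupp W := fun v hv => (mem_sdiff.1 (mem_filter.1 hv).1).2
  have hslot : ∀ v ∈ P, ∃ s : Fin 4, I.vars j s = v := fun v hv => by
    have := (mem_filter.1 hv).2
    unfold PstarSALevel.varSet at this
    obtain ⟨s, -, hs⟩ := mem_image.1 this
    exact ⟨s, hs⟩
  by_cases hx : ∃ s : Fin 4, s.val < 2 ∧ I.vars j s ∈ P
  · -- a private XOR slot outside the support: flip it if needed
    obtain ⟨s, hs, hsP⟩ := hx
    by_cases hok : I.eval z₀ j = y j
    · exact ⟨z₀, hW₀, fun j' hj' => if h : j' = j then by rw [h]; exact hok else hz₀ j' (mem_erase.2 ⟨h, hj'⟩)⟩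
    refine ⟨Function.update z₀ (I.vars j s) (!z₀ (I.vars j s)), sat_update_of_notMem (hout _ hsP) hW₀ _, fun j' hj' => ?_⟩
    by_cases h : j' = j
    · subst h
      rw [eval_update_xor_slot I hI z₀ j' s hs]
      revert hok
      cases I.eval z₀ j' <;> cases y j' <;> simp
    · rw [eval_update_of_not_mem I j' z₀ (hpriv _ hsP j' hj' h)]
      exact hz₀ j' (mem_erase.2 ⟨h, hj'⟩)
  · -- both private variables are the AND slots
    push Not at hx
    have hPsub : P ⊆ {I.vars j 2, I.vars j 3} := by
      intro v hv
      obtain ⟨s, rfl⟩ := hslot v hv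
      rw [mem_insert, mem_singleton]
      have hs2 : 2 ≤ s.val := by
        by_contra hlt2
        push Not at hlt2
        exact hx s hlt2 hv
      have : s = 2 ∨ s = 3 := by fin_cases s <;> simp at hs2 ⊢
      rcases this with rfl | rfl
      · exact Or.inl rfl
      · exact Or.inr rfl
    have hPeq : P = {I.vars j 2, I.vars j 3} :=
      eq_of_subset_of_card_le hPsub ((card_insert_le _ _).trans (by rw [card_singleton]; exact hP))
    have h2P : I.vars j 2 ∈ P := by rw [hPeq]; simp
    have h3P : I.vars j 3 ∈ P := by rw [hPeq]; simp
    set c := xor (xor (z₀ (I.vars j 0)) (z₀ (I.vars j 1))) (y j) with hc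
    refine ⟨Function.update (Function.update z₀ (I.vars j 2) c) (I.vars j 3) c,
      sat_update_of_notMem (hout _ h3P) (sat_update_of_notMem (hout _ h2P) hW₀ _) _, fun j' hj' => ?_⟩
    by_cases h : j' = j
    · subst h
      rw [eval_update_and_pair I hI z₀ j' c, hc]
      cases z₀ (I.vars j' 0) <;> cases z₀ (I.vars j' 1) <;> cases y j' <;> rfl
    · rw [eval_update_of_not_mem I j' _ (hpriv _ h3P j' hj' h), eval_update_of_not_mem I j' _ (hpriv _ h2P j' hj' h)]
      exact hz₀ j' (mem_erase.2 ⟨h, hj'⟩)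

/-! ## The support-charged bounds -/

/-- **A minimal infeasible set has at most `|J|` boundary variables outside the supports of `W`.** -/
theorem card_bdry_sdiff_wsupp_le (I : LocalMap 4 n m) (hI : I.IsPure xorAndPred) {y : Fin m → Bool}
    {W : Finset (Finset (Fin n) × Bool)} {J : Finset (Fin m)} (hmin : MinInfeasible I y W J) :
    (bdry I J \ wsupp W).card ≤ J.card := by
  by_contra hlt
  push Not at hlt
  obtain ⟨j, hj, hP⟩ := exists_two_private I J (wsupp W) hlt
  exact hmin.1 (feasible_of_two_private I hI y W hj hP (hmin.2 j hj))

/-- **The support-charged gap bound.**  On a pure `(r, 3/2)`-boundary expanding instance, a minimal `W`-infeasible set of at most `r`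
outputs has `|J| ≤ 2·|bdry J ∩ wsupp W|`: at least half of `J` is paid for by boundary variables inside the supports. -/
theorem card_le_two_mul_card_bdry_inter (I : LocalMap 4 n m) (hI : I.IsPure xorAndPred) {r : ℕ} (hB : BoundaryExpanding r I)
    {y : Fin m → Bool} {W : Finset (Finset (Fin n) × Bool)} {J : Finset (Fin m)} (hJr : J.card ≤ r)
    (hmin : MinInfeasible I y W J) : J.card ≤ 2 * (bdry I J ∩ wsupp W).card := by
  have h1 := card_bdry_sdiff_wsupp_le I hI hmin
  have h2 := hB J hJr
  have h3 := card_sdiff_add_card_inter (bdry I J) (wsupp W)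
  omega

/-- Hence `|J| ≤ 2·|wsupp W|`. -/
theorem card_le_two_mul_card_wsupp (I : LocalMap 4 n m) (hI : I.IsPure xorAndPred) {r : ℕ} (hB : BoundaryExpanding r I)
    {y : Fin m → Bool} {W : Finset (Finset (Fin n) × Bool)} {J : Finset (Fin m)} (hJr : J.card ≤ r)
    (hmin : MinInfeasible I y W J) : J.card ≤ 2 * (wsupp W).card :=
  (card_le_two_mul_card_bdry_inter I hI hB hJr hmin).trans (Nat.mul_le_mul_left 2 (card_le_card inter_subset_right))

/-- **The sparse half of the crux.**  For parity systems whose constraints have support `≤ d`, minimal infeasible sets of at most `r`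
outputs have size `≤ 2d·|W|` — the gap bound with constant `2d`, on every pure `(r, 3/2)`-expanding instance. -/
theorem card_le_of_sparse (I : LocalMap 4 n m) (hI : I.IsPure xorAndPred) {r : ℕ} (hB : BoundaryExpanding r I)
    {y : Fin m → Bool} {W : Finset (Finset (Fin n) × Bool)} {d : ℕ} (hd : ∀ e ∈ W, e.1.card ≤ d) {J : Finset (Fin m)}
    (hJr : J.card ≤ r) (hmin : MinInfeasible I y W J) : J.card ≤ 2 * d * W.card := by
  have h := card_le_two_mul_card_wsupp I hI hB hJr hmin
  have h' := card_wsupp_le hd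
  calc J.card ≤ 2 * (wsupp W).card := h
    _ ≤ 2 * (d * W.card) := Nat.mul_le_mul_left 2 h'
    _ = 2 * d * W.card := by ring

end Summit.PneNP.PneNP.Theorems.PstarGapSupport
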